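import Mathlib
import HarnessLib
import Summits.NavierStokesRegularity.NavierStokesRegularity.Theorems.UnthreadedRigidityDoorUnthreadedRigidityVirialHornDefs
import Summits.NavierStokesRegularity.NavierStokesRegularity.Theorems.UnthreadedRigidityDoorUnthreadedRigidityThreadingJetsWindowGeneric

/-!
# Route `UnthreadedRigidityDoor`, wall item W2 `UnthreadedRigidity` (stmt-NavierStokesRegularity-27585) — LINE g12-2 «PERSISTENCE FILTER»
# (ns-idea-6 g12, `Persistence_sketch.lean` 09bc8f71301208c4; idea-crit-7 g8 PASS; DIRECTOR-NS #294): support S «LINEAR LAW» (`l = 1`)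
# `LinearLaw`, VERBATIM (the sketch-local `balAmp 1` unfolded)

Seat ns-es-p1 g8 (W2 second queue; announce-before-propose on the ideators bus).

* `vortAmpL_eq_zero_of_const` — DECAY KILLS CONSTANT VORTICITY AMPLITUDES: if `K_l[H]` is constant on `(0,∞)` for a virial-admissible `H`, the
  constant is `0` (`|K(r)| ≤ |H″| + 2(l+1)|H′|/r ≤ (2l+3)·C·r^{−(l+3)}` on `[1,∞)`).
* `linearLaw` — **`LinearLaw` VERBATIM**: `b_1[H] = −K′H/r ≡ 0` on `(0,∞)` with `H` admissible and analytic forces `H ≡ 0` there.  PROOF (CARD §3.7, with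
  the Hill-interior ODE replaced by decay): `K′·H ≡ 0` with both factors analytic on the connected `(0,∞)`; if `H(r₀) ≠ 0` then `K′ = 0` near `r₀`,
  hence `K′ ≡ 0`, `K ≡ k` (constancy), `k = 0` by the first lemma, and `H ≡ 0` by the tree's `…ThreadingJets.eq_zero_of_vortAmpL_eq_zero`
  (contradiction or conclusion alike); if `H ≡ 0` there is nothing to prove.

HONEST LABEL: an elementary ODE support of a files-only rung line; nothing here bears on `UnthreadedRigidity` (27585), the door Target, W2 or Navier–Stokes
regularity; no summit statement is proved.  MODEL/rung work.
-/

noncomputable section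

-- the summit and its single sub-problem share the name (CONVENTIONS §1), as in every Theorems file
set_option linter.dupNamespace false

namespace Summit.NavierStokesRegularity.NavierStokesRegularity.Theorems.UnthreadedRigidity.Persistence

open Set Function Filter Topology
open Summit.NavierStokesRegularity.NavierStokesRegularity.Theorems.UnthreadedRigidity.VirialHorn (VirialAdmissible vortAmpL strainAmpL)
open Summit.NavierStokesRegularity.NavierStokesRegularity.Theorems.UnthreadedRigidity.ThreadingJets
  (virialAdmissible_hasDerivAt_of_pos eq_zero_of_vortAmpL_eq_zero analyticOnNhd_vortAmpL)

/-! ## Decay kills constant vorticity amplitudes -/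

/-- The vorticity amplitude of a virial-admissible profile decays: `|K_l[H](r)| ≤ (2l+3)·C·r^{−(l+3)}`-type bound, here in the weak form
`|K(r)| ≤ (2l+3)·C / r` on `[1,∞)` (enough to force a constant amplitude to vanish). -/
theorem abs_vortAmpL_le {l : ℕ} {H : ℝ → ℝ} (hH : VirialAdmissible l H) :
    ∃ C : ℝ, ∀ r : ℝ, 1 ≤ r → |vortAmpL l H r| ≤ (2 * (l : ℝ) + 3) * C / r := by
  obtain ⟨C, hC⟩ := hH.2
  refine ⟨C, fun r hr => ?_⟩
  obtain ⟨h0, h1, h2⟩ := hC r hr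
  have hr0 : 0 < r := lt_of_lt_of_le one_pos hr
  have hC0 : 0 ≤ C := le_trans (by positivity) h0
  -- `|H″| ≤ C / r^{l+4} ≤ C / r`, `|H′|/r ≤ C / r^{l+4} ≤ C / r`
  have hpow : ∀ n : ℕ, r ≤ r ^ (n + 1) := fun n => by
    calc r = r ^ 1 := (pow_one r).symm
      _ ≤ r ^ (n + 1) := pow_le_pow_right₀ hr (by omega)
  have hH2 : |deriv (deriv H) r| ≤ C / r := by
    rw [le_div_iff₀ hr0]
    calc |deriv (deriv H) r| * r ≤ |deriv (deriv H) r| * r ^ (l + 4) := by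
          apply mul_le_mul_of_nonneg_left (hpow (l + 3)) (abs_nonneg _)
      _ = r ^ (l + 4) * |deriv (deriv H) r| := mul_comm _ _
      _ ≤ C := h2
  have hH1 : |deriv H r| / r ≤ C / r := by
    rw [div_le_div_iff_of_pos_right hr0]
    calc |deriv H r| = |deriv H r| * 1 := (mul_one _).symm
      _ ≤ |deriv H r| * r ^ (l + 3) := by
          apply mul_le_mul_of_nonneg_left (one_le_pow₀ hr) (abs_nonneg _)
      _ = r ^ (l + 3) * |deriv H r| := mul_comm _ _
      _ ≤ C := h1
  unfold vortAmpL
  have hl0 : 0 ≤ 2 * ((l : ℝ) + 1) := by positivity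
  calc |deriv (deriv H) r + 2 * ((l : ℝ) + 1) / r * deriv H r|
      ≤ |deriv (deriv H) r| + |2 * ((l : ℝ) + 1) / r * deriv H r| := abs_add_le _ _
    _ = |deriv (deriv H) r| + 2 * ((l : ℝ) + 1) * (|deriv H r| / r) := by
        rw [abs_mul, abs_div, abs_of_nonneg hl0, abs_of_pos hr0]; ring
    _ ≤ C / r + 2 * ((l : ℝ) + 1) * (C / r) := by gcongr
    _ = (2 * (l : ℝ) + 3) * C / r := by ring

/-- **A constant vorticity amplitude of a virial-admissible profile is zero.** -/
theorem vortAmpL_eq_zero_of_const {l : ℕ} {H : ℝ → ℝ} (hH : VirialAdmissible l H) {k : ℝ}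
    (hk : ∀ r : ℝ, 0 < r → vortAmpL l H r = k) : k = 0 := by
  obtain ⟨C, hC⟩ := abs_vortAmpL_le hH
  have hC0 : 0 ≤ (2 * (l : ℝ) + 3) * C := by
    have h := hC 1 le_rfl
    rw [div_one] at h
    exact (abs_nonneg _).trans h
  by_contra hk0
  have hkpos : 0 < |k| := abs_pos.2 hk0
  -- at `r = ((2l+3)C + 1)/|k| + 1 ≥ 1`: `|k| ≤ (2l+3)C/r < |k|`
  set r : ℝ := ((2 * (l : ℝ) + 3) * C + 1) / |k| + 1 with hr
  have hr1 : 1 ≤ r := by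
    have : 0 ≤ ((2 * (l : ℝ) + 3) * C + 1) / |k| := by positivity
    rw [hr]; linarith
  have hr0 : 0 < r := lt_of_lt_of_le one_pos hr1
  have h1 := hC r hr1
  rw [hk r hr0, le_div_iff₀ hr0] at h1
  have h2 : |k| * r = (2 * (l : ℝ) + 3) * C + 1 + |k| := by rw [hr]; field_simp
  linarith

/-! ## The stub -/

/-- **`LinearLaw` (VERBATIM, the sketch-local `balAmp 1 H r` unfolded): `b_1[H] ≡ 0` on `(0,∞)` for an admissible analytic profile forces `H ≡ 0`
there** (module docstring for the proof). -/
theorem linearLaw :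
    ∀ (H : ℝ → ℝ), VirialAdmissible 1 H → AnalyticOnNhd ℝ H (Set.Ioi 0) →
      (∀ r : ℝ, 0 < r →
        ((1 : ℕ) : ℝ) / (2 * r) * ((((1 : ℕ) : ℝ) - 1) * vortAmpL 1 H r * deriv H r -
          (((1 : ℕ) : ℝ) + 1) * deriv (vortAmpL 1 H) r * H r) = 0) →
      ∀ r : ℝ, 0 < r → H r = 0 := by
  intro H hH hHa hb
  -- `K′ · H ≡ 0` on `(0,∞)`
  have hKH : ∀ r : ℝ, 0 < r → deriv (vortAmpL 1 H) r * H r = 0 := by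
    intro r hr
    have h := hb r hr
    have hc : ((1 : ℕ) : ℝ) / (2 * r) ≠ 0 := by
      rw [Nat.cast_one]; exact div_ne_zero one_ne_zero (by positivity)
    have h2 := (mul_eq_zero.1 h).resolve_left hc
    push_cast at h2
    linarith
  by_cases hHz : ∀ r : ℝ, 0 < r → H r = 0
  · exact hHz
  push Not at hHz
  obtain ⟨r₀, hr₀, hH0⟩ := hHz
  -- `K′ = 0` near `r₀`, hence on `(0,∞)`
  have hK : AnalyticOnNhd ℝ (vortAmpL 1 H) (Ioi 0) := analyticOnNhd_vortAmpL hHa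
  have hK' : AnalyticOnNhd ℝ (deriv (vortAmpL 1 H)) (Ioi 0) := hK.deriv
  have hne : ∀ᶠ r in 𝓝 r₀, H r ≠ 0 := (hHa r₀ hr₀).continuousAt.eventually_ne hH0
  have hev : deriv (vortAmpL 1 H) =ᶠ[𝓝 r₀] 0 := by
    filter_upwards [hne, Ioi_mem_nhds hr₀] with r hr hr0
    have h := hKH r hr0
    rcases mul_eq_zero.1 h with h1 | h1
    · exact h1
    · exact absurd h1 hr
  have hK'0 := hK'.eqOn_zero_of_preconnected_of_eventuallyEq_zero (convex_Ioi (0 : ℝ)).isPreconnected hr₀ hev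
  -- `K` is constant on `(0,∞)`
  have hKdiff : DifferentiableOn ℝ (vortAmpL 1 H) (Ioi 0) := fun r hr => (hK r hr).differentiableAt.differentiableWithinAt
  have hKconst : ∀ r ∈ Ioi (0 : ℝ), ∀ s ∈ Ioi (0 : ℝ), vortAmpL 1 H r = vortAmpL 1 H s :=
    fun r hr s hs => isOpen_Ioi.is_const_of_deriv_eq_zero (convex_Ioi 0).isPreconnected hKdiff
      (fun x hx => hK'0 hx) hr hs
  have hk : ∀ r : ℝ, 0 < r → vortAmpL 1 H r = vortAmpL 1 H 1 := fun r hr =>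
    hKconst r (mem_Ioi.2 hr) 1 (mem_Ioi.2 one_pos)
  have hk0 : vortAmpL 1 H 1 = 0 := vortAmpL_eq_zero_of_const hH hk
  -- `K ≡ 0`, so `H ≡ 0` (tree)
  exact fun r hr => (eq_zero_of_vortAmpL_eq_zero hH (fun s hs => by rw [hk s hs, hk0]) r hr).1

end Summit.NavierStokesRegularity.NavierStokesRegularity.Theorems.UnthreadedRigidity.Persistence

end
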